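import Literature.MathematicalPhysics.QuantumFieldTheory.Balaban1983to89.B9Eq3115KnitLetterYLocalQ
import Literature.MathematicalPhysics.QuantumFieldTheory.Balaban1983to89.B9CubeBondRowAgreementNearH
import Literature.MathematicalPhysics.QuantumFieldTheory.Balaban1983to89.B9Thm311CubeLettersFirstThree
import Literature.MathematicalPhysics.QuantumFieldTheory.Balaban1983to89.B9DirichletBondCubePairY

/-!
# `Balaban1983to89.B9Eq3115KnitCubeLetterY` — [Balaban1985BackgroundPropagators] (3.12)–(3.15) p. 393 ∕ p. 409 l. 1–5: PRINT's COVARIANT (KNIT) AVERAGING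
# `Q_□(U)` OF THE CUBE SEQUENCE `{Ω_n(□)}` AS A LETTER ON r05's CUBE INDEX BONDS — the SAME composite kernel as dag-n06-l's member letter `QknitY`, read at the
# index bonds of `{Ω_n(□)}`; its `U = 1` face, its adjoint's `U = 1` face, its locality, and the cube pair OF RECORD for the Dirichlet bond letter (C)

T. Bałaban, *Propagators for lattice gauge theories in a background field*, Commun. Math. Phys. **99** (1985) 389–434 [Balaban1985BackgroundPropagators] = [B9]:
(3.12)–(3.15) p. 393 (the averaging operators `Q(U)` of a sequence `{Ω_j}`: on `Λ_j` the `j`-fold composite covariant averaging; «Q … is a local operator»), p. 408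
l. −14 ff. – p. 409 l. 1–5 («a sequence {Ω_n(□)} … The operators constructed for this sequence …»), Cor. 3.5 p. 407 («for U = 1 these theorems are proved in [4]»),
(3.13) p. 393 (`Q*` the adjoint of `Q`); T. Bałaban, *Averaging operations for lattice gauge theories*, Commun. Math. Phys. **98** (1985) 17–51 [Balaban1985Averaging]:
(120)–(127) pp. 35–37 (the linearised composite averaging), p. 24 (locality, after (43)); T. Bałaban, *Propagators and renormalization transformations … II*,
Commun. Math. Phys. **96** (1984) 223–250 [Balaban1984PropagatorsII]: (2.3) p. 224 (the index bonds `Λ_j` of a sequence), (2.20) p. 226; *… I*, Commun. Math. Phys.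
**95** (1984) 17–40 [Balaban1984PropagatorsI]: (1.18) p. 20 (the flat block average).

WHY THIS FILE (seat dag-n06-d g34; this seat's ANSWER to dag-n06-c's LOCATED-34, bus 2026-08-31).  The N06 heads' member letter of record is dag-n06-l's
`QknitY i U` — `(Q(U)a)(ι) = L^{−j}·(LʲQ_j(U♯)a♯)(z_ι, κ)` on the member's index bonds `ι ∈ IBondY i` — a COMPOSITE (knit) averaging, not of transporter-conjugation
form except at `U = 1`.  Print's `G_□(U)` of the cube sequence (p. 409 l. 1–5) carries the averaging OF THE SEQUENCE `{Ω_n(□)}`: the same level-wise composite kernel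
read at the cube sequence's index bonds `IBondCubeY i □` (r05, `B9CubeLettersBondOpsL0`; both index types are subtypes of the same pairs `(j, coarse j-bond)`, the cube
sequence's `domCube i □ = domT (cubeFamY i □)` having the same `k` and the same fine torus).  This file types it:
* §1 the common row kernel `knitRowY i U a p` on the pairs `p = (j, c)` and its dependency sets `knitDepP i p` (the member's `QknitY`, `knitDepY` are these at `p = ι.1`,
  by `rfl`), locality of the kernel (`knitRowY_congr`, dag-n06-l ✓`linCovIterC_congr`);
* §2 ★ the letter `QknitCubeY i □ U : (FBondY i → 𝔸) →ₗ[ℂ] (IBondCubeY i □ → 𝔸)`, `_apply`, agreement with `QknitY` on common index bonds (`rfl`), ★ locality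
  `QknitCubeY_apply_congr`, and vanishing of a row that does not see a bond (`QknitCubeY_apply_eq_zero_of_not_mem`);
* §3 ★★ the `U = 1` FACE: the flat dictionary at the cube sequence's kernel `qKc` (`linQIter_liftBd_eq_sum_qKc`, r03's one-stroke count through
  ✓`B6Ineq2142KLevelV1L0.qwt_eq_sum` — the cube twin of ✓`B9B8KnitBondAvgDictionary.linQIter_liftBd_eq_sum_qK`), hence `QknitCubeY i □ 1 = QCubeY i □ parB 1 = (qKc)♯`;
* §4 over `M_N(ℂ)`: the adjoint letter `QsknitCubeY i □ U := adjTrY (QknitCubeY i □ U)` and its `U = 1` face `= (qsKc)♯` (r05 ✓`isAdjTr_QCubeY_QsCubeY` + def-Y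
  ✓`adjTrY_eq_of_isAdjTr`), i.e. the two flat-face sockets `h1 ∕ h1s` of ✓`B9DirichletBondCubePairY` §4 AT THE PAIR OF RECORD, and the named (C) letter of record
  `GDirCKY i □ Pl B := GDirCY i □ (QknitCubeY i □) (QsknitCubeY i □) Pl B` with its `U = 1` clause `GDirCKY_one_eq_liftOpY` (dag-n06-j's `mlocDirCMatY` by name).

HONEST SCOPE.  Definitions with bodies + exact finite algebra over landed modules; no inequality of [5] ∕ [B9]; the row agreement of this pair with the member's on the
hull (the (3.105) input) is the NEXT file.  `QknitCubeY` is corner-keyed and `L^{−n}`-normalised exactly as `QknitY`.  Count-neutral (`--supports stmt-QuantumFields-27239`);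
N06 NOT discharged; nothing continuum ∕ OS ∕ mass gap ∕ Clay — the Yang–Mills mass gap is NOT proved by any of this.  NEW file; nothing landed is modified; no `sorry`,
no `axiom`, no `instance`, no `notation`.  Net new unproved facts: 0 (five real `def`s, theorems).
-/

noncomputable section

open scoped BigOperators

namespace Literature.MathematicalPhysics.QuantumFieldTheory.Balaban1983to89.B9Eq3115KnitCubeLetterY

open B7Prop1Explicit renaming Site → LSite
open B7Prop1Explicit (e boxVec)
open B7Prop1Local (InBox loK bondHiK)
open B7Prop4Flat (linQIter linQIter_eq_linQ_pow linQ_eq_sum)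
open B7Prop4LinCovIterClosed (linCovIterC linCovIterC_add linCovIterC_smul linCovIterC_one_eq)
open B7Prop4LinCovIterClosedLaws (linCovIterC_congr)
open B10Eq27TorusAxialLog (transl)
open B5Eq118OneStroke (iterBlock)
open LatticeFieldCalculus (runBond)
open B6GlobalChartV1 (PV)
open B6KLevelCensusIndexV1 (KIdx)
open B6Cover236MultiLevelBlocks (cubes)
open B6Ineq2142KLevelV1 (cQ)
open B9B8CarrierDictionary (liftCfg liftCfg_apply)
open B9B8KnitBondTransfer (liftBd liftBd_apply)
open B9B8KnitBondAvgDictionary (linCovIter_one_eq_linQIter val_transl_boxVec transl_boxVec_mem_iterBlock transl_boxVec_of_mem_iterBlock runSite_transl)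
open B9Eq3115KnitLetterY (zSrc QknitY QknitY_apply liftCfg_const_one norm_liftBd_le)
open B9Eq3115KnitLetterYLocalQ (knitDepY)
open B9CubeLettersBondOpsL0 (IBondCubeY QCubeY QsCubeY qKc qsKc qTc QCubeY_one QsCubeY_one)
open B9CubeBondRowAgreementNearH (qKc_apply')
open B9Thm311CubeLettersFirstThree (isAdjTr_QCubeY_QsCubeY)
open B9DirichletBondCubePairY (QCLetterY QCsLetterY GDirCY GDirCY_one_eq_liftOpY isUnit_padDeltaLocCY_one padDeltaLocCY)
open B9Eq3105DirichletBondLettersAtOneY (xDirMatY mlocDirCMatY)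
open B6MultiLevelTorusOperator (mlOpT)
open B9Thm31CubeLocalFlat (wCube)
open B9CubeLettersOpsL0 (cubeFamY)
open Node00
open Node00.OpsYQLetter (adjTrY adjTrY_eq_of_isAdjTr)
open Node00.OpsYCubeDirInverse (indDiagY)
open Node00.OpsYCubeProjectionG (insideBlkY DPDsDirCubeY)
open Node00.OpsYCubeDirInverseBond (indProjY)

variable {d ℓ : ℕ} {hd : 1 ≤ d + 1} {hL : Odd (ℓ + 1) ∧ 1 < ℓ + 1} {b₀ b₁ : ℝ}

/-! ## §1 The common row kernel on the pairs `(j, c)` and its dependency sets -/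

section Kernel

variable {𝔸 : Type} [NormedRing 𝔸] [NormOneClass 𝔸] [NormedAlgebra ℂ 𝔸] [CompleteSpace 𝔸]
variable (i : KIdx d ℓ hd hL b₀ b₁)

/-- the integer label `z_c = (val (c₋)_μ)_μ` of the source of a coarse `j`-bond `c` (the member's `zSrc i ι` is this at `ι.1`, by `rfl`).
[cite: Balaban1985BackgroundPropagators, (3.12) p.393 («b ∈ Λ_j»); Balaban1984PropagatorsII, (2.1) p.224, dictionary] -/
def zSrcP (p : (j : Fin (i.k + 1)) × PBond (PV d ℓ i.m i.K hd hL) (j : ℕ)) : LSite (d + 1) := fun μ => ((p.2.src μ).val : ℤ)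

/-- the member's source label IS the pair label (`rfl`). [cite: Balaban1984PropagatorsII, (2.1) p.224, bookkeeping] -/
theorem zSrc_eq_zSrcP (ι : IBondY i) : zSrc i ι = zSrcP i ι.1 := rfl

/-- ★ **THE COMMON ROW KERNEL OF PRINT's COVARIANT AVERAGING** at a pair `p = (j, c)`: `L^{−j}·(LʲQ_j(U♯)a♯)(z_c, κ_c)` — the linearised `j`-fold composite averaging of
[5] (127) of the periodic lift `a♯` at the lifted background `U♯`, read at the corner label of `c`; it depends on `(j, c)`, `U`, `a` ONLY (no sequence of domains enters).
[cite: Balaban1985BackgroundPropagators, (3.12)–(3.15) p.393; Balaban1985Averaging, (127) p.37, (120)–(124) pp.35–36] -/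
def knitRowY (U : CfgY 𝔸 i) (a : FBondY i → 𝔸) (p : (j : Fin (i.k + 1)) × PBond (PV d ℓ i.m i.K hd hL) (j : ℕ)) : 𝔸 :=
  (((((ℓ + 1 : ℕ) : ℝ) ^ (p.1 : ℕ))⁻¹ : ℝ) : ℂ) • linCovIterC (ℓ + 1) (liftCfg U) (liftBd i a) (p.1 : ℕ) (zSrcP i p) p.2.dir

/-- ★ dag-n06-l's member letter IS the common kernel at the member's index bonds: `(QknitY i U a)(ι) = knitRowY i U a ι.1` (`rfl`).
[cite: Balaban1985BackgroundPropagators, (3.12)–(3.15) p.393, bookkeeping] -/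
theorem QknitY_apply_eq_knitRowY (U : CfgY 𝔸 i) (a : FBondY i → 𝔸) (ι : IBondY i) : QknitY i U a ι = knitRowY i U a ι.1 := rfl

/-- the kernel is additive in `a`. [cite: Balaban1985Averaging, (127) p.37, bookkeeping] -/
theorem knitRowY_add (U : CfgY 𝔸 i) (a b : FBondY i → 𝔸) (p : (j : Fin (i.k + 1)) × PBond (PV d ℓ i.m i.K hd hL) (j : ℕ)) :
    knitRowY i U (a + b) p = knitRowY i U a p + knitRowY i U b p := by
  rw [knitRowY, knitRowY, knitRowY, B9Eq3115KnitLetterY.liftBd_add, linCovIterC_add, Pi.add_apply, Pi.add_apply, smul_add]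

/-- the kernel is homogeneous in `a`. [cite: Balaban1985Averaging, (127) p.37, bookkeeping] -/
theorem knitRowY_smul (U : CfgY 𝔸 i) (c : ℂ) (a : FBondY i → 𝔸) (p : (j : Fin (i.k + 1)) × PBond (PV d ℓ i.m i.K hd hL) (j : ℕ)) :
    knitRowY i U (c • a) p = c • knitRowY i U a p := by
  rw [knitRowY, knitRowY, B9Eq3115KnitLetterY.liftBd_smul, linCovIterC_smul, Pi.smul_apply, Pi.smul_apply, smul_comm]

/-- ★ **THE DEPENDENCY SET OF A PAIR `(j, c)`**: the fine bonds `⟨0 + x, μ⟩` with `x`, `x + e_μ` in the box `[Lʲz_c, Lʲz_c + (Lʲ − 1)𝟙 + Lʲe_κ]` — the double block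
`B^j(c₋) ∪ B^j(c₊)` read through the periodic lift; the member's `knitDepY i ι` is this at `ι.1` (`rfl`). [cite: Balaban1985Averaging, p.24 (after (43)); Balaban1985BackgroundPropagators, (3.12)–(3.14) p.393, dictionary] -/
def knitDepP (p : (j : Fin (i.k + 1)) × PBond (PV d ℓ i.m i.K hd hL) (j : ℕ)) : Set (FBondY i) :=
  {b | ∃ (x : LSite (d + 1)) (μ : Fin (d + 1)),
    InBox (loK (ℓ + 1) (p.1 : ℕ) (zSrcP i p)) (bondHiK (ℓ + 1) (p.1 : ℕ) (zSrcP i p) p.2.dir) x ∧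
    InBox (loK (ℓ + 1) (p.1 : ℕ) (zSrcP i p)) (bondHiK (ℓ + 1) (p.1 : ℕ) (zSrcP i p) p.2.dir) (x + e μ) ∧
    b = ⟨transl (0 : Site (PV d ℓ i.m i.K hd hL) 0) x, μ⟩}

/-- the member's dependency sets are the pair sets (`rfl`). [cite: Balaban1985Averaging, p.24, bookkeeping] -/
theorem knitDepY_eq_knitDepP (ι : IBondY i) : knitDepY i ι = knitDepP i ι.1 := rfl

/-- membership of a box bond in the dependency set. [cite: Balaban1985Averaging, p.24, bookkeeping] -/
theorem mem_knitDepP {p : (j : Fin (i.k + 1)) × PBond (PV d ℓ i.m i.K hd hL) (j : ℕ)} {x : LSite (d + 1)} {μ : Fin (d + 1)}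
    (hx : InBox (loK (ℓ + 1) (p.1 : ℕ) (zSrcP i p)) (bondHiK (ℓ + 1) (p.1 : ℕ) (zSrcP i p) p.2.dir) x)
    (hxe : InBox (loK (ℓ + 1) (p.1 : ℕ) (zSrcP i p)) (bondHiK (ℓ + 1) (p.1 : ℕ) (zSrcP i p) p.2.dir) (x + e μ)) :
    (⟨transl (0 : Site (PV d ℓ i.m i.K hd hL) 0) x, μ⟩ : FBondY i) ∈ knitDepP i p :=
  ⟨x, μ, hx, hxe, rfl⟩

omit [NormOneClass 𝔸] in
/-- ★ **LOCALITY OF THE KERNEL**: `knitRowY i U a (j, c)` depends on `U` and `a` only through their values on `knitDepP i (j, c)` (dag-n06-l ✓`linCovIterC_congr`).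
[cite: Balaban1985BackgroundPropagators, (3.12)–(3.15) p.393 («Q … is a local operator»); Balaban1985Averaging, p.24 (after (43))] -/
theorem knitRowY_congr {U U' : CfgY 𝔸 i} {a a' : FBondY i → 𝔸} (p : (j : Fin (i.k + 1)) × PBond (PV d ℓ i.m i.K hd hL) (j : ℕ))
    (hU : ∀ b ∈ knitDepP i p, U b.2 b.1 = U' b.2 b.1) (ha : ∀ b ∈ knitDepP i p, a b = a' b) :
    knitRowY i U a p = knitRowY i U' a' p := by
  rw [knitRowY, knitRowY,
    linCovIterC_congr (ℓ + 1) (Nat.succ_pos ℓ) (p.1 : ℕ) (zSrcP i p) p.2.dir (fun x μ hx hxe => ?_) (fun x μ hx hxe => ?_)]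
  · rw [liftCfg_apply, liftCfg_apply]
    exact hU _ (mem_knitDepP i hx hxe)
  · rw [liftBd_apply, liftBd_apply]
    exact ha _ (mem_knitDepP i hx hxe)

/-- hence a row that does not see the support of `a` vanishes: `a = 0` on `knitDepP i p` ⇒ `knitRowY i U a p = 0`.
[cite: Balaban1985BackgroundPropagators, (3.12)–(3.14) p.393 («Q … is a local operator»), bookkeeping] -/
theorem knitRowY_eq_zero_of_forall (U : CfgY 𝔸 i) {a : FBondY i → 𝔸} (p : (j : Fin (i.k + 1)) × PBond (PV d ℓ i.m i.K hd hL) (j : ℕ))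
    (ha : ∀ b ∈ knitDepP i p, a b = 0) : knitRowY i U a p = 0 := by
  have h0 : knitRowY i U (0 : FBondY i → 𝔸) p = 0 := by
    have h := knitRowY_smul i U (0 : ℂ) a p
    rwa [zero_smul, zero_smul] at h
  rw [knitRowY_congr i p (U' := U) (a' := 0) (fun _ _ => rfl) (fun b hb => by rw [ha b hb, Pi.zero_apply]), h0]

end Kernel

/-! ## §2 The letter `Q_□(U)` of the cube sequence -/

section Letter

variable {𝔸 : Type} [NormedRing 𝔸] [NormOneClass 𝔸] [NormedAlgebra ℂ 𝔸] [CompleteSpace 𝔸]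
variable (i : KIdx d ℓ hd hL b₀ b₁) (q : ↥(cubes (toKT i).D.toDomains))

/-- ★★ **`QknitCubeY i □ U` — PRINT's COVARIANT AVERAGING `Q_□(U)` OF THE SEQUENCE `{Ω_n(□)}`** (p. 409 l. 1–5 with (3.12)–(3.15)): on the index bond
`ι = ⟨n, ⟨ι₋, κ⟩⟩ ∈ Λ_n(□)` of the cube sequence, `(Q_□(U)a)(ι) := L^{−n}·(LⁿQ_n(U♯)a♯)(z_ι, κ)` — the common kernel `knitRowY` at `ι.1`.  `ℂ`-linear for every `U`.
[cite: Balaban1985BackgroundPropagators, (3.12)–(3.15) p.393, p.409 l.1–5; Balaban1985Averaging, (127) p.37] -/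
def QknitCubeY (U : CfgY 𝔸 i) : (FBondY i → 𝔸) →ₗ[ℂ] (IBondCubeY i q → 𝔸) where
  toFun a ι := knitRowY i U a ι.1
  map_add' a b := by
    funext ι
    exact knitRowY_add i U a b ι.1
  map_smul' c a := by
    funext ι
    exact knitRowY_smul i U c a ι.1

/-- `QknitCubeY`, evaluated. [cite: Balaban1985BackgroundPropagators, (3.12)–(3.15) p.393, bookkeeping] -/
theorem QknitCubeY_apply (U : CfgY 𝔸 i) (a : FBondY i → 𝔸) (ι : IBondCubeY i q) : QknitCubeY i q U a ι = knitRowY i U a ι.1 := rfl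

/-- `QknitCubeY`, fully unfolded. [cite: Balaban1985BackgroundPropagators, (3.12)–(3.15) p.393, bookkeeping] -/
theorem QknitCubeY_apply' (U : CfgY 𝔸 i) (a : FBondY i → 𝔸) (ι : IBondCubeY i q) :
    QknitCubeY i q U a ι = (((((ℓ + 1 : ℕ) : ℝ) ^ (ι.1.1 : ℕ))⁻¹ : ℝ) : ℂ) •
      linCovIterC (ℓ + 1) (liftCfg U) (liftBd i a) (ι.1.1 : ℕ) (zSrcP i ι.1) ι.1.2.dir := rfl

/-- ★ **ON A COMMON INDEX BOND THE TWO LETTERS AGREE**: if the pair `ι.1` of a cube index bond is also an index bond of the member, `(Q_□(U)a)(ι) = (Q(U)a)⟨ι.1, _⟩`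
(`rfl` — both are the common kernel). [cite: Balaban1985BackgroundPropagators, (3.12)–(3.14) p.393, p.409 l.1–5; Balaban1984PropagatorsII, (2.3) p.224] -/
theorem QknitCubeY_apply_eq_QknitY_apply (U : CfgY 𝔸 i) (a : FBondY i → 𝔸) (ι : IBondCubeY i q)
    (hD : (B6GlobalChartV1.domT i.hN i.D i.hk).LamBond (ι.1.1 : ℕ) ι.1.2) :
    QknitCubeY i q U a ι = QknitY i U a ⟨ι.1, hD⟩ := rfl

/-- ★ **(L2) LOCALITY OF `Q_□(U)`**: `(Q_□(U)a)(ι)` depends on `U` and `a` only through their values on `knitDepP i ι.1`.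
[cite: Balaban1985BackgroundPropagators, (3.12)–(3.15) p.393 («Q … is a local operator»); Balaban1985Averaging, p.24] -/
theorem QknitCubeY_apply_congr {U U' : CfgY 𝔸 i} {a a' : FBondY i → 𝔸} (ι : IBondCubeY i q)
    (hU : ∀ b ∈ knitDepP i ι.1, U b.2 b.1 = U' b.2 b.1) (ha : ∀ b ∈ knitDepP i ι.1, a b = a' b) :
    QknitCubeY i q U a ι = QknitCubeY i q U' a' ι :=
  knitRowY_congr i ι.1 hU ha

/-- a row that does not see the support of `a` vanishes. [cite: Balaban1985BackgroundPropagators, (3.12)–(3.14) p.393, bookkeeping] -/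
theorem QknitCubeY_apply_eq_zero_of_forall (U : CfgY 𝔸 i) {a : FBondY i → 𝔸} (ι : IBondCubeY i q) (ha : ∀ b ∈ knitDepP i ι.1, a b = 0) :
    QknitCubeY i q U a ι = 0 :=
  knitRowY_eq_zero_of_forall i U ι.1 ha

/-- the member twin: a row of `QknitY` that does not see the support of `a` vanishes. [cite: Balaban1985BackgroundPropagators, (3.12)–(3.14) p.393, bookkeeping] -/
theorem QknitY_apply_eq_zero_of_forall (U : CfgY 𝔸 i) {a : FBondY i → 𝔸} (ι : IBondY i) (ha : ∀ b ∈ knitDepP i ι.1, a b = 0) :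
    QknitY i U a ι = 0 :=
  knitRowY_eq_zero_of_forall i U ι.1 ha

end Letter

/-! ## §3 The `U = 1` face: the flat dictionary at the cube sequence's kernel `qKc` -/

section Flat

variable {𝔸 : Type} [NormedRing 𝔸] [NormedAlgebra ℂ 𝔸]
variable (i : KIdx d ℓ hd hL b₀ b₁) (q : ↥(cubes (toKT i).D.toDomains))

/-- [folklore] a kernel given by an indicator count collapses the sum: `Σ_f (Σ_{p∈s} [φ p = f])·g(f) = Σ_{p∈s} g(φ p)`. -/
private theorem sum_count_smul_eq {X β : Type*} [Fintype X] [DecidableEq X] (s : Finset β) (φ : β → X) (g : X → 𝔸) :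
    ∑ f, (((∑ p ∈ s, (if φ p = f then (1 : ℝ) else 0)) : ℝ) : ℂ) • g f = ∑ p ∈ s, g (φ p) := by
  simp_rw [Complex.ofReal_sum, Finset.sum_smul]
  rw [Finset.sum_comm]
  refine Finset.sum_congr rfl fun p _ => ?_
  rw [Finset.sum_eq_single (φ p)]
  · rw [if_pos rfl, Complex.ofReal_one, one_smul]
  · intro f _ hf
    rw [if_neg (Ne.symm hf), Complex.ofReal_zero, zero_smul]
  · intro h
    exact absurd (Finset.mem_univ _) h

/-- ★★ **THE BOND-AVERAGING DICTIONARY AT THE CUBE SEQUENCE's KERNEL (flat)**: for an index bond `ι` of `{Ω_n(□)}` of level `n` and direction `μ`, and any `z ∈ ℤ^{d+1}` with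
`0 + z = ι₋` on `T^{(n)}`, `linQIter L (a♯) n z μ = Lⁿ·Σ_f qKc ι f·a(f)` — r03's one-stroke count (✓`B6Ineq2142KLevelV1L0.qwt_eq_sum`) against [5]'s flat composite
averaging, exactly as ✓`linQIter_liftBd_eq_sum_qK` for the member. [cite: Balaban1984PropagatorsI, (1.18) p.20; Balaban1985Averaging, (125) p.36, (127) p.37; Balaban1985BackgroundPropagators, (3.12) p.392, p.409 l.1–5] -/
theorem linQIter_liftBd_eq_sum_qKc (ι : IBondCubeY i q) (z : LSite (d + 1))
    (hz : transl (0 : Site (PV d ℓ i.m i.K hd hL) (ι.1.1 : ℕ)) z = ι.1.2.src) (a : FBondY i → 𝔸) :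
    linQIter (ℓ + 1) (liftBd i a) (ι.1.1 : ℕ) z ι.1.2.dir =
      (((((ℓ + 1 : ℕ) : ℝ)) ^ (ι.1.1 : ℕ) : ℝ) : ℂ) • ∑ f, ((qKc i q ι f : ℝ) : ℂ) • a f := by
  classical
  set j : ℕ := (ι.1.1 : ℕ) with hjdef
  set N : ℕ := (ℓ + 1) ^ j with hN
  set μ := ι.1.2.dir with hμ
  have hj : j ≤ i.m + i.K := B6Ineq2142KLevelV1L0.lvl_le_mK i.hN (cubeFamY i q) i.hk ι
  have hN0 : 0 < N := by positivity
  -- the cube sequence's side: the one-stroke pair count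
  have hY : ∑ f, ((qKc i q ι f : ℝ) : ℂ) • a f =
      ((cQ (d := d) (ℓ := ℓ) j : ℝ) : ℂ) • ∑ x ∈ iterBlock j ι.1.2.src, ∑ t ∈ Finset.range N, a (runBond x μ t) := by
    have hq : ∀ f, qKc i q ι f = cQ (d := d) (ℓ := ℓ) j *
        ∑ p ∈ iterBlock j ι.1.2.src ×ˢ Finset.range N, (if runBond p.1 μ p.2 = f then (1 : ℝ) else 0) := fun f => by
      rw [qKc_apply', B6Ineq2142KLevelV1L0.qwt_eq_sum, Finset.sum_product]
    simp_rw [hq, Complex.ofReal_mul, mul_smul]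
    rw [← Finset.smul_sum, sum_count_smul_eq, Finset.sum_product]
  -- knit side: the one-stroke block sum of the lift
  have hK : linQIter (ℓ + 1) (liftBd i a) j z μ =
      ∑ r : Fin (d + 1) → Fin N, (((N : ℝ) ^ (d + 1))⁻¹) • ∑ s : Fin N, a (runBond (transl (0 : Site (PV d ℓ i.m i.K hd hL) 0)
        (((N : ℕ) : ℤ) • z + boxVec N r)) μ s) := by
    rw [linQIter_eq_linQ_pow, linQ_eq_sum]
    refine Finset.sum_congr rfl fun r _ => ?_
    congr 1
    refine Finset.sum_congr rfl fun s _ => ?_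
    rw [liftBd_apply, runBond, runSite_transl]
  rw [hK, hY, ← Finset.smul_sum, smul_smul]
  -- the scalars: `Lʲ·cQ j = (Lʲ)^{-(d+1)}`
  have hscal : (((((ℓ + 1 : ℕ) : ℝ)) ^ j : ℝ) : ℂ) * ((cQ (d := d) (ℓ := ℓ) j : ℝ) : ℂ) = ((((N : ℝ) ^ (d + 1))⁻¹ : ℝ) : ℂ) := by
    rw [← Complex.ofReal_mul]
    congr 1
    rw [B6Ineq2142KLevelV1.cQ, hN, Nat.cast_pow, ← pow_mul, ← pow_mul, mul_comm (d + 1) j]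
    have hL0 : (((ℓ + 1 : ℕ) : ℝ)) ^ j ≠ 0 := by positivity
    field_simp
  rw [← Complex.coe_smul, ← hscal]
  congr 1
  -- the bijection `r ↦ 0 + (Lʲz + r)` between `[0, Lʲ)^{d+1}` and `B^j(ι₋)`
  rw [← hz]
  refine Finset.sum_bij' (fun r _ => transl (0 : Site (PV d ℓ i.m i.K hd hL) 0) (((N : ℕ) : ℤ) • z + boxVec N r))
    (fun x _ => fun ν => ⟨(x ν).val % N, Nat.mod_lt _ hN0⟩) (fun r _ => transl_boxVec_mem_iterBlock hj z r) (fun _ _ => Finset.mem_univ _)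
    (fun r _ => ?_) (fun x hx => transl_boxVec_of_mem_iterBlock hj z hx) (fun r _ => ?_)
  · funext ν
    apply Fin.ext
    show (transl (0 : Site (PV d ℓ i.m i.K hd hL) 0) (((N : ℕ) : ℤ) • z + boxVec N r) ν).val % N = r ν
    rw [val_transl_boxVec hj z r ν, Nat.mul_add_mod, Nat.mod_eq_of_lt (r ν).2]
  · rw [← Fin.sum_univ_eq_sum_range]

/-- the same, AS r05's `Q_□(1)`: `linQIter L (a♯) n z μ = Lⁿ·(Q_□(1)a)(ι)` with `Q_□(1) = QCubeY parB 1` (trivial transporters; any `parB`).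
[cite: Balaban1985BackgroundPropagators, (3.12) p.392, p.409 l.1–5; Balaban1985Averaging, (127) p.37] -/
theorem linQIter_liftBd_eq_QCubeY_one [CompleteSpace 𝔸] (parB : BondParY 𝔸 i) (hpar : ∀ z w, parB (fun _ _ => (1 : 𝔸ˣ)) z w = 1)
    (ι : IBondCubeY i q) (z : LSite (d + 1)) (hz : transl (0 : Site (PV d ℓ i.m i.K hd hL) (ι.1.1 : ℕ)) z = ι.1.2.src) (a : FBondY i → 𝔸) :
    linQIter (ℓ + 1) (liftBd i a) (ι.1.1 : ℕ) z ι.1.2.dir =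
      (((((ℓ + 1 : ℕ) : ℝ)) ^ (ι.1.1 : ℕ) : ℝ) : ℂ) • QCubeY i q parB (fun _ _ => (1 : 𝔸ˣ)) a ι := by
  rw [linQIter_liftBd_eq_sum_qKc i q ι z hz a, QCubeY, trLiftY_apply]
  congr 1
  refine Finset.sum_congr rfl fun f _ => ?_
  rw [qTc, hpar, B9Eq39Adjoint.R_one]

/-- `0 + z_c = c₋` on the level-`j` torus for a pair `(j, c)` (the member's `transl_zero_zSrc` at the pair). [cite: Balaban1984PropagatorsII, (2.1) p.224, dictionary] -/
theorem transl_zero_zSrcP (p : (j : Fin (i.k + 1)) × PBond (PV d ℓ i.m i.K hd hL) (j : ℕ)) :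
    transl (0 : Site (PV d ℓ i.m i.K hd hL) (p.1 : ℕ)) (zSrcP i p) = p.2.src := by
  funext ν
  rw [B10Eq27TorusAxialLog.transl_apply, zSrcP, show (0 : Site (PV d ℓ i.m i.K hd hL) (p.1 : ℕ)) ν = 0 from rfl, zero_add]
  simp

variable [NormOneClass 𝔸] [CompleteSpace 𝔸]

/-- ★★ **THE `U = 1` CLAUSE**: at the trivial background print's `Q_□(1)` IS r05's flat cube averaging `Q_□(1) = QCubeY i □ parB 1` — for every bond transporter table with
`parB 1 = 1` («for U = 1 these theorems are proved in [4]», Cor. 3.5).  (dag-n06-l's `QknitY_one`, at the cube sequence's index bonds.)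
[cite: Balaban1985BackgroundPropagators, Cor. 3.5 p.407, (3.12) p.393, p.409 l.1–5; Balaban1984PropagatorsI, (1.18) p.20] -/
theorem QknitCubeY_one (parB : BondParY 𝔸 i) (hpar : ∀ z w, parB (fun _ _ => (1 : 𝔸ˣ)) z w = 1) :
    QknitCubeY i q (fun _ _ => (1 : 𝔸ˣ)) = QCubeY i q parB (fun _ _ => (1 : 𝔸ˣ)) := by
  apply LinearMap.ext; intro a; funext ι
  have hL1 : 1 ≤ ℓ + 1 := Nat.succ_pos ℓ
  have hflat : linCovIterC (ℓ + 1) (liftCfg (P := PV d ℓ i.m i.K hd hL) (fun _ _ => (1 : 𝔸ˣ))) (liftBd i a) (ι.1.1 : ℕ)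
      = linQIter (ℓ + 1) (liftBd i a) (ι.1.1 : ℕ) := by
    rw [liftCfg_const_one, linCovIterC_one_eq]
    exact linCovIter_one_eq_linQIter hL1 (liftBd i a) (Finset.sum_nonneg fun f _ => norm_nonneg (a f)) (norm_liftBd_le i a) _
  rw [QknitCubeY_apply', hflat, linQIter_liftBd_eq_QCubeY_one i q parB hpar ι (zSrcP i ι.1) (transl_zero_zSrcP i ι.1) a, smul_smul, ← Complex.ofReal_mul,
    inv_mul_cancel₀ (by positivity), Complex.ofReal_one, one_smul]

/-- ★ hence `Q_□(1) = (qKc)♯` — the flat-face socket `h1` of ✓`B9DirichletBondCubePairY` §4. [cite: Balaban1985BackgroundPropagators, Cor. 3.5 p.407, p.395 («Q(1) = Q»), p.409 l.1–5] -/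
theorem QknitCubeY_one_liftMatY : QknitCubeY i q (fun _ _ => (1 : 𝔸ˣ)) = liftMatY 𝔸 (qKc i q) := by
  rw [QknitCubeY_one i q (parB := fun _ _ _ => 1) (fun _ _ => rfl)]
  exact QCubeY_one i q (parB := fun _ _ _ => 1) (fun _ _ => rfl)

end Flat

/-! ## §4 Over `M_N(ℂ)`: the adjoint letter, its `U = 1` face, and the Dirichlet bond letter (C) at the pair of record -/

section Record

open scoped Matrix.Norms.L2Operator

variable {N : ℕ} [Nonempty (Fin N)] (i : KIdx d ℓ hd hL b₀ b₁) (q : ↥(cubes (toKT i).D.toDomains))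

/-- ★ **THE ADJOINT LETTER `Q*_□(U) := adjTrY (Q_□(U))`** of the cube sequence for print's scalar products ((3.13); def-Y's generic adjoint, cf. `qsKnitOfRecord`).
[cite: Balaban1985BackgroundPropagators, (3.13) p.393, p.409 l.1–5] -/
def QsknitCubeY : QCsLetterY (Matrix (Fin N) (Fin N) ℂ) i q := fun U => adjTrY (QknitCubeY i q U)

/-- `QsknitCubeY`, unfolded (`rfl`). [cite: Balaban1985BackgroundPropagators, (3.13) p.393, bookkeeping] -/
theorem QsknitCubeY_apply (U : CfgY (Matrix (Fin N) (Fin N) ℂ) i) : QsknitCubeY i q U = adjTrY (QknitCubeY i q U) := rfl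

/-- ★ **THE `U = 1` FACE OF THE ADJOINT**: `Q*_□(1) = (qsKc)♯` — the generic adjoint of `Q_□(1) = QCubeY parB 1` IS r05's `QsCubeY parB 1` (✓`isAdjTr_QCubeY_QsCubeY` at the
trivial, unitary transporters + ✓`adjTrY_eq_of_isAdjTr`), the lift of `q*_□` (`QsCubeY_one`) — the flat-face socket `h1s` of ✓`B9DirichletBondCubePairY` §4.
[cite: Balaban1985BackgroundPropagators, (3.13) p.393, Cor. 3.5 p.407, p.409 l.1–5] -/
theorem QsknitCubeY_one : QsknitCubeY (N := N) i q (fun _ _ => 1) = liftMatY (Matrix (Fin N) (Fin N) ℂ) (qsKc i q) := by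
  rw [QsknitCubeY_apply, QknitCubeY_one i q (parB := fun _ _ _ => 1) (fun _ _ => rfl),
    adjTrY_eq_of_isAdjTr (isAdjTr_QCubeY_QsCubeY i q (G := B7Prop2Explicit.unitaryUnits (Matrix (Fin N) (Fin N) ℂ)) le_rfl (fun _ _ _ => 1)
      (fun _ _ => 1) fun _ _ => Subgroup.one_mem _)]
  exact QsCubeY_one i q (parB := fun _ _ _ => 1) (fun _ _ => rfl)

/-- ★★ **THE DIRICHLET BOND LETTER (C) OF RECORD**: `G_□(U) := GDirCY i □ (Q_□) (Q*_□) Pl B` at the cube sequence's knit pair — print's `G_□(U)` of p. 409 l. 1–5 once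
`Pl_□ := DP_□D*` and `B := Ω₀(□)` are pinned (the heads' pins: def-Y's `DPDsDirCubeY i □ Ω₀(□)`, `bondsOverY Ω₀(□)`).
[cite: Balaban1985BackgroundPropagators, p.409 l.1–5 («G_□(U)»), (3.26)–(3.27) p.395, (3.105) p.414] -/
abbrev GDirCKY (Pl : CfgY (Matrix (Fin N) (Fin N) ℂ) i → Module.End ℂ (FBondY i → Matrix (Fin N) (Fin N) ℂ)) (B : Finset (FBondY i)) :
    BondOpY (Matrix (Fin N) (Fin N) ℂ) i :=
  GDirCY i q (QknitCubeY i q) (QsknitCubeY i q) Pl B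

/-- `GDirCKY` (a reducible abbreviation), unfolded (`rfl`). [cite: Balaban1985BackgroundPropagators, p.409 l.1–5, bookkeeping] -/
theorem GDirCKY_eq (Pl : CfgY (Matrix (Fin N) (Fin N) ℂ) i → Module.End ℂ (FBondY i → Matrix (Fin N) (Fin N) ℂ)) (B : Finset (FBondY i)) :
    GDirCKY i q Pl B = GDirCY i q (QknitCubeY i q) (QsknitCubeY i q) Pl B := rfl

/-- ★ **THE REGIME AT `U = 1` FOR THE LETTER OF RECORD** at def-Y's projection pin `Pl_□ := DPDsDirCubeY i □ S`: from the three displayed real inverse sockets (sites of `S`,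
blocks inside `S`, bonds of `B`) of dag-n06-j's matrix `mlocDirCMatY i □ S K K_X`. [cite: Balaban1985BackgroundPropagators, p.395 («if U = 1»), Cor. 3.5 p.407, p.409 l.1–5] -/
theorem isUnit_padDeltaLocCY_knitCube_one (S : Finset (SiteY i)) {K : Matrix (SiteY i) (SiteY i) ℝ}
    (hK : (mlOpT (toKT i).NB ℓ (toKT i).k (cubeFamY i q).lev (wCube ℓ)).submatrix (fun v : ↥S => (v : SiteY i)) (fun v : ↥S => (v : SiteY i)) *
      K.submatrix (fun v : ↥S => (v : SiteY i)) (fun v : ↥S => (v : SiteY i)) = 1)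
    {KX : Matrix (B9CubeLettersBondOpsL0.BlkCubeY i q) (B9CubeLettersBondOpsL0.BlkCubeY i q) ℝ}
    (hKX : (xDirMatY i q S K).submatrix (fun v : ↥(insideBlkY i q S) => (v : B9CubeLettersBondOpsL0.BlkCubeY i q))
        (fun v : ↥(insideBlkY i q S) => (v : B9CubeLettersBondOpsL0.BlkCubeY i q)) *
      KX.submatrix (fun v : ↥(insideBlkY i q S) => (v : B9CubeLettersBondOpsL0.BlkCubeY i q))
        (fun v : ↥(insideBlkY i q S) => (v : B9CubeLettersBondOpsL0.BlkCubeY i q)) = 1)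
    (B : Finset (FBondY i)) {KB : Matrix (FBondY i) (FBondY i) ℝ}
    (hKB : (mlocDirCMatY i q S K KX).submatrix (fun v : ↥B => (v : FBondY i)) (fun v : ↥B => (v : FBondY i)) *
      KB.submatrix (fun v : ↥B => (v : FBondY i)) (fun v : ↥B => (v : FBondY i)) = 1) :
    IsUnit (padDeltaLocCY i q (QknitCubeY i q) (QsknitCubeY (N := N) i q) (DPDsDirCubeY i q S) B (fun _ _ => 1)) :=
  isUnit_padDeltaLocCY_one i (QknitCubeY i q) (QsknitCubeY i q) (QknitCubeY_one_liftMatY i q) (QsknitCubeY_one i q) S hK hKX B hKB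

/-- ★★ **THE `U = 1` CLAUSE FOR THE LETTER OF RECORD**: `G_□(1) = (𝟙_B K_B 𝟙_B)♯` for any real `K_B` inverting the compression of `mlocDirCMatY i □ S K K_X` to `B` —
the socket the `U = 1` Dirichlet bond kernel rows of dag-n06-c's road (B5) plug into. [cite: Balaban1985BackgroundPropagators, p.395 («if U = 1»), Cor. 3.5 p.407, p.409 l.1–5; Balaban1983RegularityDecay, (2.42) p.584] -/
theorem GDirCKY_one_eq_liftOpY (S : Finset (SiteY i)) {K : Matrix (SiteY i) (SiteY i) ℝ}
    (hK : (mlOpT (toKT i).NB ℓ (toKT i).k (cubeFamY i q).lev (wCube ℓ)).submatrix (fun v : ↥S => (v : SiteY i)) (fun v : ↥S => (v : SiteY i)) *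
      K.submatrix (fun v : ↥S => (v : SiteY i)) (fun v : ↥S => (v : SiteY i)) = 1)
    {KX : Matrix (B9CubeLettersBondOpsL0.BlkCubeY i q) (B9CubeLettersBondOpsL0.BlkCubeY i q) ℝ}
    (hKX : (xDirMatY i q S K).submatrix (fun v : ↥(insideBlkY i q S) => (v : B9CubeLettersBondOpsL0.BlkCubeY i q))
        (fun v : ↥(insideBlkY i q S) => (v : B9CubeLettersBondOpsL0.BlkCubeY i q)) *
      KX.submatrix (fun v : ↥(insideBlkY i q S) => (v : B9CubeLettersBondOpsL0.BlkCubeY i q))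
        (fun v : ↥(insideBlkY i q S) => (v : B9CubeLettersBondOpsL0.BlkCubeY i q)) = 1)
    (B : Finset (FBondY i)) {KB : Matrix (FBondY i) (FBondY i) ℝ}
    (hKB : (mlocDirCMatY i q S K KX).submatrix (fun v : ↥B => (v : FBondY i)) (fun v : ↥B => (v : FBondY i)) *
      KB.submatrix (fun v : ↥B => (v : FBondY i)) (fun v : ↥B => (v : FBondY i)) = 1) :
    GDirCKY i q (DPDsDirCubeY i q S) B (fun _ _ => 1) = liftOpY (Matrix (Fin N) (Fin N) ℂ) (indDiagY B * KB * indDiagY B) :=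
  GDirCY_one_eq_liftOpY i (QknitCubeY i q) (QsknitCubeY i q) (QknitCubeY_one_liftMatY i q) (QsknitCubeY_one i q) S hK hKX B hKB

end Record

end Literature.MathematicalPhysics.QuantumFieldTheory.Balaban1983to89.B9Eq3115KnitCubeLetterY

end
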